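import Summits.AtomisticToContinuum.Crystallization.Theorems.OverbindingBudgetElasticSplitRelaxed
import Summits.AtomisticToContinuum.Crystallization.Theorems.ChartedPlanarOrderDoorLayeredExact

/-!
# OverbindingBudget — «ElasticSplit» (7): the Liouville leaf cut at EXACT TWO-PERIODICITY (lens-4 g28; critic row 410 (2))

Helper file (`--supports stmt-AtomisticToContinuum-31280`).  After `LocalRelaxationTest` became a theorem (`localRelaxationTest_record`)
the RDEF cone of record reads `GrossCleanBallsU → ChargedEnergyGap → CompressedVirialLaw → ShearFreeLiouvilleLaw → CleanlessExcessT →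
CoherentResidual → RobustDefectLimitWindows` (`…ElasticSplitRelaxed`).  Here the Liouville leaf `ShearFreeLiouvilleLaw T₀ D` (SFL) is cut
in the COMMON TARGET FORM «class ⟹ `TwoPeriodic Λ`» of the cell (tree currency `ChartedPlanarOrderDoorLayered.TwoPeriodic Λ S`: two
linearly independent EXACT periods of length `≤ Λ`; lens-3 g22, landed by hand-2 g8), so that the N-column (`DoorPeriodic Λ`) and this
column aim at ONE Liouville statement:

* `Unstrained Y := ∀ κ > 0, ¬ StrainedCubes κ Y` (the negation of SFL's conclusion; it implies `VirialBalanced Y` and `StressFree Y` by the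
  tree's dilation and shear tests, `virialBalanced_of_unstrained` / `stressFree_of_unstrained`);
* **L_opt** `OptimalTexturePeriodic Λ T₀ D`: an UNSTRAINED texture of the uncompressed recurrent clean class with sparse charge that is
  locally optimal is two-periodic with periods `≤ Λ` (discrete nonlinear elastic LIOUVILLE + defect-freeness of the clean class; the
  positive content of SFL; UNDECIDED·TRUE-type);
* **E_per** `PeriodicStrainedCubes Λ T₀ D`: SFL restricted to two-periodic textures — a two-periodic texture of that class which is
  `(t, L)`-strained at every admissible scale has strained cubes (layer-chain / homogeneous-strain energy; ATTACKABLE·L).  KERNEL-WEAKER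
  than SFL (`periodicStrainedCubes_of_shearFree`).

PROVED: the seam `shearFreeLiouvilleLaw_of_periodic : L_opt Λ → E_per Λ → SFL` (excluded middle on `Unstrained Y`), the converse
`shearFreeLiouvilleLaw_iff_periodic` given L_opt, monotonicity in `Λ`, the CALIBRATION `not_twoPeriodic_of_cleanClass_of_lt` (a clean
texture has no period shorter than its hard core `47/50·49/50 − T₀`, so L_opt below that length says the class is EMPTY — read L_opt only at
`Λ ≥ 1`; currency of record `Λ₀ = 2`), the critic's shorter form `OptimalTexturePeriodicVB` (virial-balanced instead of unstrained,
compressed scale allowed) implies L_opt, and the two cones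
`rdef_of_grossU_periodicSplit : GrossCleanBallsU (1/250) 10 → ChargedEnergyGap → CompressedVirialLaw (1/250) 10 → OptimalTexturePeriodic Λ (1/250) 10
→ PeriodicStrainedCubes Λ (1/250) 10 → CleanlessExcessT → CoherentResidual 10 → RobustDefectLimitWindows` (every `Λ`) and its `LocalVirialLaw` twin.
NOT in this file (next, critic row 410 (2)): the convergence edge `CleanCharted T₀ → DoorPeriodic Λ → OptimalTexturePeriodic Λ T₀ D`
(waits for `DoorPeriodic` = part C of the DoorLayered landing and the lemma «clean ⟹ Barlow-bond-charted»).
-/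

namespace Summit.AtomisticToContinuum.Crystallization.Theorems.OverbindingBudgetElasticSplitPeriodic

open Literature.MathematicalPhysics.StatisticalMechanics (UniformlyDiscrete)
open Summit.AtomisticToContinuum.Crystallization.Theses.OverbindingBudget (RobustDefectLimitWindows)
open Summit.AtomisticToContinuum.Crystallization.Theses.PricedLinkCensus (ChargedEnergyGap)
open Summit.AtomisticToContinuum.Crystallization.Theorems.OverbindingBudgetGradedBareness (CleanlessExcessT)
open Summit.AtomisticToContinuum.Crystallization.Theorems.OverbindingBudgetCoherentCut (CoherentResidual)
open Summit.AtomisticToContinuum.Crystallization.Theorems.OverbindingBudgetUniformCutStatements (GrossCleanBallsU)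
open Summit.AtomisticToContinuum.Crystallization.Theorems.OverbindingBudgetViolatorDensityFloor (RT)
open Summit.AtomisticToContinuum.Crystallization.Theorems.OverbindingBudgetEdgeRelaxationStatements (CleanClass StrainedCubes)
open Summit.AtomisticToContinuum.Crystallization.Theorems.OverbindingBudgetRecurrentDustStatements (ViolatorsL)
open Summit.AtomisticToContinuum.Crystallization.Theorems.OverbindingBudgetElasticSplitStatements (SparseCharge LocallyOptimal VirialBalanced)
open Summit.AtomisticToContinuum.Crystallization.Theorems.OverbindingBudgetElasticSplitDilation (strainedCubes_of_not_virialBalanced)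
open Summit.AtomisticToContinuum.Crystallization.Theorems.OverbindingBudgetElasticSplitScale (HasCompressedScale CompressedVirialLaw)
open Summit.AtomisticToContinuum.Crystallization.Theorems.OverbindingBudgetElasticSplitShear (StressFree ShearFreeLiouvilleLaw
  strainedCubes_of_not_stressFree)
open Summit.AtomisticToContinuum.Crystallization.Theorems.OverbindingBudgetElasticSplitLocalVirial (LocalVirialLaw)
open Summit.AtomisticToContinuum.Crystallization.Theorems.OverbindingBudgetElasticSplitRelaxed (rdef_of_grossU_shearSplit_relaxed
  rdef_of_grossU_localVirial_relaxed)
open Summit.AtomisticToContinuum.Crystallization.Theorems.ChartedPlanarOrderDoorLayered (IsPeriod TwoPeriodic TwoPeriodic.mono)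

/-! ## §1 Unstrained textures -/

/-- `Unstrained Y`: no `κ > 0` is an energy excess rate on cofinal cubes — the negation of the conclusion of every RELAX-type law. -/
def Unstrained (Y : Set (EuclideanSpace ℝ (Fin 3))) : Prop :=
  ∀ κ : ℝ, 0 < κ → ¬ StrainedCubes κ Y

/-- An unstrained texture passes the dilation test (tree: `strainedCubes_of_not_virialBalanced`). [this file] -/
theorem virialBalanced_of_unstrained {Y : Set (EuclideanSpace ℝ (Fin 3))} (h : Unstrained Y) : VirialBalanced Y := by
  by_contra hvb
  obtain ⟨κ, hκ, hs⟩ := strainedCubes_of_not_virialBalanced hvb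
  exact h κ hκ hs

/-- An unstrained uniformly discrete texture passes every shear test (tree: `strainedCubes_of_not_stressFree`). [this file] -/
theorem stressFree_of_unstrained {Y : Set (EuclideanSpace ℝ (Fin 3))} (hY : UniformlyDiscrete Y) (h : Unstrained Y) : StressFree Y := by
  by_contra hsf
  obtain ⟨κ, hκ, hs⟩ := strainedCubes_of_not_stressFree hY hsf
  exact h κ hκ hs

/-- Excluded middle in the form used by every seam below: a texture is unstrained or has strained cubes. [this file] -/
theorem unstrained_or_strained (Y : Set (EuclideanSpace ℝ (Fin 3))) : Unstrained Y ∨ ∃ κ : ℝ, 0 < κ ∧ StrainedCubes κ Y := by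
  by_cases h : Unstrained Y
  · exact Or.inl h
  · right
    unfold Unstrained at h
    push Not at h
    exact h

/-! ## §2 The two pieces -/

/-- **L_opt · `OptimalTexturePeriodic Λ T₀ D`** (the Liouville statement of the RDEF column, in the cell's common target form): an UNSTRAINED,
locally optimal texture of the uncompressed recurrent clean class with sparse charge is TWO-PERIODIC with periods of length `≤ Λ`.
Read at `Λ ≥ 1` only (`not_twoPeriodic_of_cleanClass_of_lt`); currency of record `Λ₀ = 2`.  UNDECIDED·TRUE-type. [piece] -/
def OptimalTexturePeriodic (Λ T₀ D : ℝ) : Prop :=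
  ∀ Y : Set (EuclideanSpace ℝ (Fin 3)), CleanClass T₀ D Y → ¬ HasCompressedScale T₀ Y → SparseCharge Y → LocallyOptimal Y →
    Unstrained Y → TwoPeriodic Λ Y

/-- **E_per · `PeriodicStrainedCubes Λ T₀ D`**: `ShearFreeLiouvilleLaw` RESTRICTED to two-periodic textures — a two-periodic, locally optimal
texture of the uncompressed recurrent clean class with sparse charge that is `(t, L)`-strained at every admissible scale has strained cubes.
KERNEL-WEAKER than SFL (`periodicStrainedCubes_of_shearFree`); ATTACKABLE (layer-chain energy of a stacking of identical strained layers). [piece] -/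
def PeriodicStrainedCubes (Λ T₀ D : ℝ) : Prop :=
  ∀ Y : Set (EuclideanSpace ℝ (Fin 3)), CleanClass T₀ D Y → ¬ HasCompressedScale T₀ Y → SparseCharge Y → LocallyOptimal Y →
    TwoPeriodic Λ Y → ∀ t : ℝ, 0 < t → ∀ L : ℝ, (∀ a' : ℝ, 47 / 50 ≤ a' → a' ≤ 1 → ViolatorsL a' t L Y) →
      ∃ κ : ℝ, 0 < κ ∧ StrainedCubes κ Y

/-- The critic's shorter form (row 410 (2)): virial-balanced instead of unstrained, compressed scales allowed.  KERNEL-STRONGER than L_opt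
(`optimalTexturePeriodic_of_VB`). [piece] -/
def OptimalTexturePeriodicVB (Λ T₀ D : ℝ) : Prop :=
  ∀ Y : Set (EuclideanSpace ℝ (Fin 3)), CleanClass T₀ D Y → SparseCharge Y → LocallyOptimal Y → VirialBalanced Y → TwoPeriodic Λ Y

/-! ## §3 The seam and the kernel relations -/

/-- **THE SEAM.** `L_opt Λ ∧ E_per Λ ⟹ ShearFreeLiouvilleLaw` (excluded middle on `Unstrained Y`). [this file] -/
theorem shearFreeLiouvilleLaw_of_periodic {Λ T₀ D : ℝ} (hL : OptimalTexturePeriodic Λ T₀ D) (hE : PeriodicStrainedCubes Λ T₀ D) :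
    ShearFreeLiouvilleLaw T₀ D := by
  intro Y hY hnc hsc hlo _hvb _hsf t ht L hV
  rcases unstrained_or_strained Y with hu | hs
  · exact hE Y hY hnc hsc hlo (hL Y hY hnc hsc hlo hu) t ht L hV
  · exact hs

/-- E_per is KERNEL-WEAKER than SFL. [this file] -/
theorem periodicStrainedCubes_of_shearFree {Λ T₀ D : ℝ} (h : ShearFreeLiouvilleLaw T₀ D) : PeriodicStrainedCubes Λ T₀ D := by
  intro Y hY hnc hsc hlo _hper t ht L hV
  rcases unstrained_or_strained Y with hu | hs
  · exact h Y hY hnc hsc hlo (virialBalanced_of_unstrained hu) (stressFree_of_unstrained hY.1 hu) t ht L hV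
  · exact hs

/-- Given L_opt, the Liouville leaf IS its periodic restriction. [this file] -/
theorem shearFreeLiouvilleLaw_iff_periodic {Λ T₀ D : ℝ} (hL : OptimalTexturePeriodic Λ T₀ D) :
    ShearFreeLiouvilleLaw T₀ D ↔ PeriodicStrainedCubes Λ T₀ D :=
  ⟨periodicStrainedCubes_of_shearFree, fun hE => shearFreeLiouvilleLaw_of_periodic hL hE⟩

/-- The critic's form implies L_opt (an unstrained texture is virial-balanced). [this file] -/
theorem optimalTexturePeriodic_of_VB {Λ T₀ D : ℝ} (h : OptimalTexturePeriodicVB Λ T₀ D) : OptimalTexturePeriodic Λ T₀ D :=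
  fun Y hY _hnc hsc hlo hu => h Y hY hsc hlo (virialBalanced_of_unstrained hu)

/-- L_opt is monotone in `Λ`. [this file] -/
theorem OptimalTexturePeriodic.mono {Λ Λ' T₀ D : ℝ} (hΛ : Λ ≤ Λ') (h : OptimalTexturePeriodic Λ T₀ D) : OptimalTexturePeriodic Λ' T₀ D :=
  fun Y hY hnc hsc hlo hu => (h Y hY hnc hsc hlo hu).mono hΛ

/-- E_per is antitone in `Λ`. [this file] -/
theorem PeriodicStrainedCubes.anti {Λ Λ' T₀ D : ℝ} (hΛ : Λ ≤ Λ') (h : PeriodicStrainedCubes Λ' T₀ D) : PeriodicStrainedCubes Λ T₀ D :=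
  fun Y hY hnc hsc hlo hper t ht L hV => h Y hY hnc hsc hlo (hper.mono hΛ) t ht L hV

/-! ## §4 Calibration: no short periods in the clean class -/

/-- A nonzero period of a texture containing `0` is a point of the texture. [folklore] -/
theorem mem_of_isPeriod {Y : Set (EuclideanSpace ℝ (Fin 3))} {v : EuclideanSpace ℝ (Fin 3)} (h0 : (0 : EuclideanSpace ℝ (Fin 3)) ∈ Y)
    (hv : IsPeriod Y v) : v ∈ Y := by
  have := (hv 0).2 h0
  rwa [zero_add] at this

/-- In the clean class every nonzero period is at least the hard core `a (1 − 1/50) − T₀ ≥ 47/50 · 49/50 − T₀` long. [this file] -/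
theorem norm_period_ge_of_cleanClass {T₀ D : ℝ} {Y : Set (EuclideanSpace ℝ (Fin 3))} (hY : CleanClass T₀ D Y) {v : EuclideanSpace ℝ (Fin 3)}
    (hv : IsPeriod Y v) (hv0 : v ≠ 0) : 47 / 50 * (49 / 50) - T₀ ≤ ‖v‖ := by
  obtain ⟨-, h0, -, -, -, a, ha, -, hclean⟩ := hY
  have hvY : v ∈ Y := mem_of_isPeriod h0 hv
  have h := ((hclean 0 h0).2.2 v hvY hv0).1
  rw [dist_comm, dist_eq_norm, sub_zero] at h
  nlinarith [h, ha]

/-- **CALIBRATION (w0).** Below the hard core there are no periods: `TwoPeriodic Λ Y` FAILS for every texture of the clean class when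
`Λ < 47/50 · 49/50 − T₀`; so `OptimalTexturePeriodic Λ T₀ D` at such `Λ` asserts that the class is EMPTY — read L_opt at `Λ ≥ 1` only. [this file] -/
theorem not_twoPeriodic_of_cleanClass_of_lt {Λ T₀ D : ℝ} {Y : Set (EuclideanSpace ℝ (Fin 3))} (hY : CleanClass T₀ D Y)
    (hΛ : Λ < 47 / 50 * (49 / 50) - T₀) : ¬ TwoPeriodic Λ Y := by
  rintro ⟨a, b, hab, ha, -, hpa, -⟩
  have ha0 : a ≠ 0 := by
    have := hab.ne_zero 0
    simpa using this
  have := norm_period_ge_of_cleanClass hY hpa ha0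
  linarith

/-! ## §5 The cones -/

/-- **RDEF cone with the Liouville leaf cut at two-periodicity** (every `Λ`): `GrossCleanBallsU (1/250) 10 → ChargedEnergyGap →
CompressedVirialLaw (1/250) 10 → OptimalTexturePeriodic Λ (1/250) 10 → PeriodicStrainedCubes Λ (1/250) 10 → CleanlessExcessT → CoherentResidual 10 →
RobustDefectLimitWindows`. [this file] -/
theorem rdef_of_grossU_periodicSplit (Λ : ℝ) (hG : GrossCleanBallsU (1 / 250) 10) (hCEG : ChargedEnergyGap)
    (hC : CompressedVirialLaw (1 / 250) 10) (hL : OptimalTexturePeriodic Λ (1 / 250) 10) (hE : PeriodicStrainedCubes Λ (1 / 250) 10)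
    (hCE : CleanlessExcessT) (hR : CoherentResidual 10) : RobustDefectLimitWindows :=
  rdef_of_grossU_shearSplit_relaxed hG hCEG hC (shearFreeLiouvilleLaw_of_periodic hL hE) hCE hR

/-- The same cone with the EOS branch as the per-site virial certificate `LocalVirialLaw`. [this file] -/
theorem rdef_of_grossU_localVirial_periodicSplit (Λ : ℝ) (hG : GrossCleanBallsU (1 / 250) 10) (hCEG : ChargedEnergyGap)
    (hV : LocalVirialLaw (1 / 250) 10) (hL : OptimalTexturePeriodic Λ (1 / 250) 10) (hE : PeriodicStrainedCubes Λ (1 / 250) 10)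
    (hCE : CleanlessExcessT) (hR : CoherentResidual 10) : RobustDefectLimitWindows :=
  rdef_of_grossU_localVirial_relaxed hG hCEG hV (shearFreeLiouvilleLaw_of_periodic hL hE) hCE hR

/-- Record instance at the currency of record `Λ₀ = 2` (the critic's shorter L_opt form also suffices, `optimalTexturePeriodic_of_VB`). [this file] -/
theorem rdef_of_grossU_periodicSplit_record (hG : GrossCleanBallsU (1 / 250) 10) (hCEG : ChargedEnergyGap)
    (hC : CompressedVirialLaw (1 / 250) 10) (hL : OptimalTexturePeriodicVB 2 (1 / 250) 10) (hE : PeriodicStrainedCubes 2 (1 / 250) 10)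
    (hCE : CleanlessExcessT) (hR : CoherentResidual 10) : RobustDefectLimitWindows :=
  rdef_of_grossU_periodicSplit 2 hG hCEG hC (optimalTexturePeriodic_of_VB hL) hE hCE hR

end Summit.AtomisticToContinuum.Crystallization.Theorems.OverbindingBudgetElasticSplitPeriodic
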